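import Summits.CriticalPhenomena.PercolationContinuityZ3.Theorems.Transplant.SkelPhiFaceNumsY2S
import Summits.CriticalPhenomena.PercolationContinuityZ3.Theorems.Transplant.SkelPhiFaceNumsY2
import Summits.CriticalPhenomena.PercolationContinuityZ3.Theorems.Transplant.SkelPhiFaceNumsMkY4ES
import Summits.CriticalPhenomena.PercolationContinuityZ3.Theorems.Transplant.SkelPhiFaceNumsMkY4E
import Summits.CriticalPhenomena.PercolationContinuityZ3.Theorems.Transplant.SkelPhiFaceNumsY2E
import Literature.Probability.Percolation.OrientedHistorySiteRenormalizationRun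
import Summits.CriticalPhenomena.PercolationContinuityZ3.Theorems.Transplant.SkelPhiFaceTargetMMS
import Summits.CriticalPhenomena.PercolationContinuityZ3.Theorems.Transplant.PlanarCells2SDefs
import HarnessLib
/-!
# N2 (frames-only node `SamePDropOfSkeletonFrm₁`, OPEN) — WAVE 1, (F) face-data column over STAGGERED cells ((R-22) `PCells2S`, (R-28)(β) one landing per file): the twin of N1's `SkelPhiFaceNumsY2E`

builds on p205010 (kernel theorem, internal audit signed; external expert review pending) — nothing in this file uses p205010; NOTHING is claimed about the
open node `SamePDropOfSkeletonFrm₁` (`SamePDropOfSkeletonNeg₁` is CLOSED in the tree and untouched by this file).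
Status sentence (coordinator 2026-08-20T04:30Z): "θ(p_c) = 0 on ℤ^d, all d ≥ 2 — kernel-verified (Lean 4/Mathlib, standard axioms); internal adversarial
audit SIGNED 2026-08-20 04:29Z; external expert review pending."
Lane `prim-bschramm`, seat `prim-hp-8` (gen 40); helper file (`--supports stmt-CriticalPhenomena-4575 --as helper`); design owner p3-g15 ((R-22) staggered
cells `PCells2S`, (R-27)/(R-29) far regions of record `FarNS/FarNS₂`, (R-28)(β), naming 2026-08-22T23:00:04Z: suffix `S`).
PORT RULES (HOME/prim-hp-8/code/gen40/orient/bin/port_s.py = stmt-g19's port_orient.py + the G token table): the cells are `P : PCells2S`, every box is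
read about the STAGGERED centre `cenS` (`PlanarCells2SDefs/SFar/ContainS/SArm/SepS/SepInfS/LevelsS/EfarN2S`), the scheme record is `cellGeomSG₂S`/`cellGeomSG₂bS`
(`SkelPhiCellsWeakGS/…SmallMS`: narrow arm `BtwNS`, two-block far region `FarNS₂`), the history-site API is the ORIENTED one at `qNE` where it occurs
(`ochoice qNE`, `onwardO`, `Valid₂O`, `IsRun₂O`, …, (R-18)); EVERY declaration is re-declared with the suffix `S` (same namespace). Docstrings/citations are N1's.
N1 HEADER (kept for the reader):
[cite: KozmaNitzan2024, §4 Lemma 11 (pp. 22–23), Lemma 12 (pp. 23–25)] [cite: MartineauTassion2017, §4.3 Lemma 4.2]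
-/
noncomputable section

open scoped Classical

namespace Summit.CriticalPhenomena.PercolationContinuityZ3.Theorems.Transplant

namespace Skelφ

open Literature.Probability.Percolation Literature.Probability.LatticeModels SimpleGraph KNCells
open Literature.Probability.Percolation.KozmaNitzan
open Literature.Probability.Percolation.KozmaNitzan.Cells (oth oth_ne sgOf sgOf_sign stepVec_apply_fst eq_oth_of_ne oth_oth)
open KNLevels ChainPlanar ChainPara
open Literature.Barriers.CriticalPhenomena (graphBall mem_graphBall_self graphBall_mono)
open BoxProdZ2 (ConcRadiiG)
open TwoAxis.Para (modulus coarse lam0 lam1)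

variable {V : Type} [DecidableEq V] {G : SimpleGraph V} [G.LocallyFinite] {φ : V → Site 2}

/-- **THE PER-CENTRE NUMBERS OF A y′-FACE FROM LINEAR FLOORS, v2** (see the module docstring). -/
theorem numsY_of_floors₂ES (hstep : Steps G φ) (pr : FinePrm) (w₀ : V) {nL : ℕ} (hn : pr.n = nL) (hnL : 1 ≤ nL) (hvL : |pr.vα| ≤ nL)
    (hD : 0 < pr.D) (hlipψ : Lip G (pr.ψ φ w₀)) (hws : WeakSteps G (pr.ψ φ w₀))
    -- the lattice in stride units
    {κ₀ κ₁ mod Vb : ℤ} (hA : 0 < pr.A) (hκ₀ : 0 ≤ κ₀) (hVb : |pr.vα| ≤ Vb) (hc0 : pr.c₀ = pr.A * κ₀) (hc1 : pr.c₁ = pr.A * κ₁)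
    (hmod : modulus nL pr.h pr.vα pr.vβ = mod) (hmod0 : 0 < mod) (hDm : pr.D = pr.A ^ 2 * mod)
    {ℓ' : ℕ} (hlay : (nL + pr.h.natAbs : ℕ) ≤ (nL : ℤ) * ℓ' + 1) (hmodlo : (nL : ℤ) * ℓ' - (shearUnit nL pr.h : ℤ) + 1 ≤ mod)
    (hmodhi : mod ≤ (nL : ℤ) * ℓ')
    -- the face step and the centre
    (P : PCells2S) (Λ : ConcRadiiG) (b₀ : Fin 2 → ℕ) (a' : ℕ) (x : Site 2) (du : MDir) (hdu : du.1 = 1) (j : ℕ) {L' : ℕ} (hL' : 1 ≤ L')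
    (hrM : L' ≤ Λ.rM a' (x + stepVec du)) {k₀ : ℤ} (hk₀ : 0 ≤ k₀) {r : ℕ} (c : V) (hcw : c ∈ graphBall G w₀ (Λ.rE a' x du - r))
    (hrE : r ≤ Λ.rE a' x du) (Mz : ℕ)
    {wc : ℤ} (hwc : |pr.ψ φ w₀ c (oth du.1) - P.cenS x (oth du.1)| ≤ wc)
    {flo fhi fw : ℤ} (hflo : 5 * (P.r du.1 : ℤ) + 10 * P.s du.1 * j + 3 ≤ flo + P.lev du x (pr.ψ φ w₀ c))
    (hfhi : fhi + P.lev du x (pr.ψ φ w₀ c) ≤ 25 * P.r du.1 - 2) (hfw : fw + wc + k₀ + 1 + P.c du.1 ≤ 5 * (P.r (oth du.1) : ℤ) - 3)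
    {kpar kperp : ℤ} (hfR : flo ≤ -kpar ∧ kpar ≤ fhi ∧ kperp ≤ fw)
    (Zc : Finset V) {kZ : ℤ} (hZk : ∀ v ∈ Zc, |pr.ψ φ c v du.1| ≤ kZ) (hZfar : P.lev du x (pr.ψ φ w₀ c) + kZ + 1 < 20 * (P.r du.1 : ℤ) - b₀ du.1)
    -- the run data and the choices
    {σh : ℤ} (hσh : σh = 1 ∨ σh = -1) (B : BridgePrm) (R's qB R'₃ qB₃ : ℕ) (yL : Site 2) (Nr N₃ : ℕ) {σT : ℤ} (hσT : σT = 1 ∨ σT = -1)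
    -- floors: along y′-run at yL (sign σ = sgOf du): along habitat on axis 1, transverse on axis 0
    (FA1 : sgOf du = 1 → ∀ k ≤ Nr, mod * (flo - coarse pr.c₁ (pr.D / 2) pr.D (lam1 pr.A nL pr.h yL)) ≤
      κ₁ * ((shearUnit nL pr.h : ℤ) * (ySLo nL ℓ' pr.h qB R's 1 k - 1)) - mod + 1)
    (FA2 : sgOf du = 1 → ∀ k ≤ Nr, mod * (coarse pr.c₁ (pr.D / 2) pr.D (lam1 pr.A nL pr.h yL) + 1) +
      κ₁ * ((shearUnit nL pr.h : ℤ) * ySHi nL ℓ' pr.h qB R's 1 k + shearUnit nL pr.h - 1) ≤ mod * fhi)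
    (FA3 : sgOf du = -1 → ∀ k ≤ Nr, mod * (flo + coarse pr.c₁ (pr.D / 2) pr.D (lam1 pr.A nL pr.h yL) + 1) ≤
      -(κ₁ * ((shearUnit nL pr.h : ℤ) * ySHi nL ℓ' pr.h qB R's (-1) k + shearUnit nL pr.h - 1)))
    (FA4 : sgOf du = -1 → ∀ k ≤ Nr, -(mod * coarse pr.c₁ (pr.D / 2) pr.D (lam1 pr.A nL pr.h yL)) -
      κ₁ * ((shearUnit nL pr.h : ℤ) * (ySLo nL ℓ' pr.h qB R's (-1) k - 1)) + mod - 1 ≤ mod * fhi)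
    (FA5 : ∀ k ≤ Nr, (nL : ℤ) * mod * (-fw - coarse pr.c₀ (pr.D / 2) pr.D (lam0 pr.A pr.vα pr.vβ yL)) ≤ -(κ₀ * (yBnd nL ℓ' pr.h mod qB R's k + 2 * nL)) - nL * mod)
    (FA6 : ∀ k ≤ Nr, (nL : ℤ) * mod * (coarse pr.c₀ (pr.D / 2) pr.D (lam0 pr.A pr.vα pr.vβ yL) + 1) + κ₀ * (yBnd nL ℓ' pr.h mod qB R's k + nL) ≤ nL * mod * fw)
    -- floors: tangential x-run at yT (sign σT)
    (FT1 : sgOf du = 1 → ∀ k ≤ N₃, mod * (flo - coarse pr.c₁ (pr.D / 2) pr.D (lam1 pr.A nL pr.h (yL + crossOffY nL ℓ' pr.h pr.vα (sgOf du) Nr))) ≤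
      -(κ₁ * (shearUnit nL pr.h : ℤ) * (xBoxB nL ℓ' pr.h R'₃ k + 1)) - mod + 1)
    (FT2 : sgOf du = 1 → ∀ k ≤ N₃, mod * (coarse pr.c₁ (pr.D / 2) pr.D (lam1 pr.A nL pr.h (yL + crossOffY nL ℓ' pr.h pr.vα (sgOf du) Nr)) + 1) +
      κ₁ * ((shearUnit nL pr.h : ℤ) * xBoxB nL ℓ' pr.h R'₃ k + shearUnit nL pr.h - 1) ≤ mod * fhi)
    (FT3 : sgOf du = -1 → ∀ k ≤ N₃, mod * (flo + coarse pr.c₁ (pr.D / 2) pr.D (lam1 pr.A nL pr.h (yL + crossOffY nL ℓ' pr.h pr.vα (sgOf du) Nr)) + 1) ≤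
      -(κ₁ * ((shearUnit nL pr.h : ℤ) * xBoxB nL ℓ' pr.h R'₃ k + shearUnit nL pr.h - 1)))
    (FT4 : sgOf du = -1 → ∀ k ≤ N₃, -(mod * coarse pr.c₁ (pr.D / 2) pr.D (lam1 pr.A nL pr.h (yL + crossOffY nL ℓ' pr.h pr.vα (sgOf du) Nr))) +
      κ₁ * (shearUnit nL pr.h : ℤ) * (xBoxB nL ℓ' pr.h R'₃ k + 1) + mod - 1 ≤ mod * fhi)
    (FT5 : ∀ k ≤ N₃, (nL : ℤ) * mod * (-fw - coarse pr.c₀ (pr.D / 2) pr.D (lam0 pr.A pr.vα pr.vβ (yL + crossOffY nL ℓ' pr.h pr.vα (sgOf du) Nr))) ≤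
      κ₀ * mod * xSLo nL qB₃ R'₃ σT k - κ₀ * Vb * (shearUnit nL pr.h : ℤ) * (xBoxB nL ℓ' pr.h R'₃ k + 1) - κ₀ * nL - nL * mod)
    (FT6 : ∀ k ≤ N₃, (nL : ℤ) * mod * (coarse pr.c₀ (pr.D / 2) pr.D (lam0 pr.A pr.vα pr.vβ (yL + crossOffY nL ℓ' pr.h pr.vα (sgOf du) Nr)) + 1) +
      κ₀ * mod * xSHi nL qB₃ R'₃ σT k + κ₀ * Vb * (shearUnit nL pr.h : ℤ) * (xBoxB nL ℓ' pr.h R'₃ k + 1) ≤ nL * mod * fw)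
    -- floors: the target box on the x-run's last core
    (FL1 : (nL : ℤ) * mod * (P.cenS (x + stepVec du) 0 - b₀ 0 + 2 - pr.ψ φ w₀ c 0 -
      coarse pr.c₀ (pr.D / 2) pr.D (lam0 pr.A pr.vα pr.vβ (yL + crossOffY nL ℓ' pr.h pr.vα (sgOf du) Nr))) ≤
      κ₀ * mod * xCSLo nL qB₃ R'₃ σT (N₃ + 1) - κ₀ * Vb * (shearUnit nL pr.h : ℤ) * (xCoreB nL ℓ' pr.h R'₃ (N₃ + 1) + 1) - κ₀ * nL - nL * mod)
    (FL2 : (nL : ℤ) * mod * (coarse pr.c₀ (pr.D / 2) pr.D (lam0 pr.A pr.vα pr.vβ (yL + crossOffY nL ℓ' pr.h pr.vα (sgOf du) Nr)) + 1) +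
      κ₀ * mod * xCSHi nL qB₃ R'₃ σT (N₃ + 1) + κ₀ * Vb * (shearUnit nL pr.h : ℤ) * (xCoreB nL ℓ' pr.h R'₃ (N₃ + 1) + 1) ≤
      nL * mod * (P.cenS (x + stepVec du) 0 + b₀ 0 - 2 - pr.ψ φ w₀ c 0))
    (FL3 : mod * (P.cenS (x + stepVec du) 1 - b₀ 1 + 2 - pr.ψ φ w₀ c 1 - coarse pr.c₁ (pr.D / 2) pr.D (lam1 pr.A nL pr.h (yL + crossOffY nL ℓ' pr.h pr.vα (sgOf du) Nr))) ≤
      -(κ₁ * (shearUnit nL pr.h : ℤ) * (xCoreB nL ℓ' pr.h R'₃ (N₃ + 1) + 1)) - mod + 1)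
    (FL4 : mod * (coarse pr.c₁ (pr.D / 2) pr.D (lam1 pr.A nL pr.h (yL + crossOffY nL ℓ' pr.h pr.vα (sgOf du) Nr)) + 1) +
      κ₁ * ((shearUnit nL pr.h : ℤ) * xCoreB nL ℓ' pr.h R'₃ (N₃ + 1) + shearUnit nL pr.h - 1) ≤ mod * (P.cenS (x + stepVec du) 1 + b₀ 1 - 2 - pr.ψ φ w₀ c 1))
    -- the cross link floors
    (hq₃ : 2 * (nL : ℤ) + ((Nr : ℤ) + 1) * R's ≤ qB₃)
    (hW : ((Nr : ℤ) + 1) * (((nL : ℤ) * ℓ' / (shearUnit nL pr.h : ℕ) + 1) - ((nL : ℤ) * ℓ' - (shearUnit nL pr.h : ℕ) + 1) / (shearUnit nL pr.h : ℕ)) + qB +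
      ((Nr : ℤ) + 1) * R's + 2 ≤ ((nL * ℓ' / shearUnit nL pr.h + 1 : ℕ) : ℤ))
    -- the bridge box, clearances, reaches
    (hxaY : ∀ x ∈ Finset.Icc B.core1Lo B.core1Hi,
      -((((nL : ℤ) + pr.vα).toNat : ℕ) : ℤ) ≤ sgOf du * σh * x 0 - sgOf du * yL 0 ∧ sgOf du * σh * x 0 - sgOf du * yL 0 ≤ ((((nL : ℤ) - pr.vα).toNat : ℕ) : ℤ))
    (hxbY : ∀ x ∈ Finset.Icc B.core1Lo B.core1Hi,
      |sgOf du * ((nL : ℤ) * (x 1 - yL 1) - pr.h * (σh * x 0 - yL 0))| + shearUnit nL pr.h ≤ ((qB : ℤ) + 1) * shearUnit nL pr.h)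
    -- seed clearances: along y′-run by the signed α-floor on the side `s_h = sgOf du·σh`; tangential x-run per region by α OR by level
    (hclrLo : sgOf du * σh = 1 → ∀ k ≤ Nr, (Mz : ℤ) < yBoxLoT nL pr.vα R's k + sgOf du * yL 0)
    (hclrHi : sgOf du * σh = -1 → ∀ k ≤ Nr, yBoxHiT nL pr.vα R's k + sgOf du * yL 0 < -(Mz : ℤ))
    (hclr₃ : ∀ k ≤ N₃, (∀ b : ℤ, min (σT * xBoxLoA nL qB₃ R'₃ k) (σT * xBoxHiA nL qB₃ R'₃ k) ≤ b →
      b ≤ max (σT * xBoxLoA nL qB₃ R'₃ k) (σT * xBoxHiA nL qB₃ R'₃ k) → (Mz : ℤ) < |b + (yL + crossOffY nL ℓ' pr.h pr.vα (sgOf du) Nr) 0|) ∨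
      ((shearUnit nL pr.h : ℤ) * Mz + (shearUnit nL pr.h : ℤ) * (xBoxB nL ℓ' pr.h R'₃ k + 1) ≤
        |(nL : ℤ) * (yL + crossOffY nL ℓ' pr.h pr.vα (sgOf du) Nr) 1 - pr.h * (yL + crossOffY nL ℓ' pr.h pr.vα (sgOf du) Nr) 0|))
    (hπ2Y : ∀ k ≤ Nr, ((yL 0).natAbs + (yL 1).natAbs) + (((((k + 1 : ℕ) : ℤ) * pr.vα).natAbs +
      (((shearUnit nL pr.h : ℤ) * |((k + 1 : ℕ) : ℤ) * (yPrmW nL ℓ' pr.h pr.vα R's qB Nr).sLo| + |pr.h| * |((k + 1 : ℕ) : ℤ) * pr.vα| + shearUnit nL pr.h) / nL).natAbs + 1))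
      ≤ r)
    (hπ3Y : (((yL + crossOffY nL ℓ' pr.h pr.vα (sgOf du) Nr) 0).natAbs + ((yL + crossOffY nL ℓ' pr.h pr.vα (sgOf du) Nr) 1).natAbs) + (N₃ + 1) * shearUnit nL pr.h ≤ r) :
    ∃ N : FaceRunNumsY4 G φ (pr.ψ φ w₀) c pr.A nL pr.h pr.vα pr.vβ pr.c₀ pr.c₁ pr.D du σh (sgOf du) B ℓ' R's qB R'₃ qB₃ pr.vα hnL hvL hlay Mz
      (P.farCore x du j k₀) (targetMMS G φ pr P w₀ Λ b₀ a' x du L') Zc r kpar kperp, N.Nr = Nr ∧ N.N₃ = N₃ := by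
  set yT := yL + crossOffY nL ℓ' pr.h pr.vα (sgOf du) Nr with hyT
  have hσ := sgOf_sign du
  -- the three footprint packages
  obtain ⟨PLO, PHI, hreg, hP0, hP1, hP2, hP3, hPf₁, hPf₂, hPf₃⟩ :=
    yRun_footprint_of_floors_yface hnL hA hκ₀ hc0 hc1 hmod hmod0 hDm hvL hlay hmodlo hmodhi yL du hdu R's qB Nr FA1 FA2 FA3 FA4 FA5 FA6
  obtain ⟨YLO, YHI, hregY, hY0, hY1, hY2, hY3, hYf₁, hYf₂, hYf₃⟩ :=
    xRun_footprint_of_floors_yface (vβ := pr.vβ) hnL pr.h hA hκ₀ hc0 hc1 hmod hmod0 hDm hVb yT hσT du hdu ℓ' R'₃ qB₃ N₃ FT1 FT2 FT3 FT4 FT5 FT6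
  obtain ⟨LLO, LHI, hlastc, hL0, hL1, hL2, hL3, hglo, hghi⟩ :=
    lastCoreX_target_of_floors (vβ := pr.vβ) hnL pr.h hA hκ₀ hc0 hc1 hmod hmod0 hDm hVb yT hσT ℓ' R'₃ qB₃ N₃ (pr.ψ φ w₀ c) (P.cenS (x + stepVec du)) b₀
      FL1 FL2 FL3 FL4
  -- the numeric cross link
  have hxyY := hxyY_of_floors hnL (h := pr.h) hvL hσ hσT ℓ' R's qB Nr R'₃ qB₃ N₃ hq₃ hW
  have hd : yT - yL = crossOffY nL ℓ' pr.h pr.vα (sgOf du) Nr := by rw [hyT, add_sub_cancel_left]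
  -- the tangential clearance in the constructor's box spelling (`max |−xBoxB| |xBoxB| = xBoxB`)
  have hclr₃' : ∀ k ≤ N₃, (∀ b : ℤ, min (σT * xBoxLoA nL qB₃ R'₃ k) (σT * xBoxHiA nL qB₃ R'₃ k) ≤ b →
      b ≤ max (σT * xBoxLoA nL qB₃ R'₃ k) (σT * xBoxHiA nL qB₃ R'₃ k) → (Mz : ℤ) < |b + yT 0|) ∨
      ((shearUnit nL pr.h : ℤ) * Mz + (shearUnit nL pr.h : ℤ) * (max |(-xBoxB nL ℓ' pr.h R'₃ k)| |xBoxB nL ℓ' pr.h R'₃ k| + 1) ≤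
        |(nL : ℤ) * yT 1 - pr.h * yT 0|) := by
    intro k hk
    rcases hclr₃ k hk with h | h
    · exact Or.inl h
    · right
      rwa [abs_neg, max_self, abs_of_nonneg (xBoxB_nonneg nL ℓ' pr.h R'₃ k)]
  exact faceRunNumsY4_mkES hstep pr w₀ hn hnL hvL hD hlipψ hws P Λ b₀ a' x du j hL' hrM hk₀ c hcw hrE Mz le_rfl le_rfl hwc hflo hfhi hfw
    hglo hghi hfR Zc hZk hZfar hσh B ℓ' R's qB R'₃ qB₃ hlay yL yT Nr N₃ hσT PLO PHI YLO YHI hreg hregY hlastc hP0 hP1 hP2 hP3 hPf₁ hPf₂ hPf₃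
    hY0 hY1 hY2 hY3 hYf₁ hYf₂ hYf₃ hL0 hL1 hL2 hL3 hxaY hxbY (by rw [hd]; exact hxyY) hclrLo hclrHi hclr₃' hπ2Y hπ3Y

end Skelφ

end Summit.CriticalPhenomena.PercolationContinuityZ3.Theorems.Transplant

end
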